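import Literature.NumberTheory.LFunctions.UniformClassGroupPNT
import Literature.NumberTheory.LFunctions.PrimeIdealPsi
import HarnessLib

/-!
# The Chebyshev function `θ_C` of an ideal class and the partial summation `θ_C ⇒ π_C`

Topic `Literature/NumberTheory/LFunctions` (namespace `Literature.NumberTheory.LFunctions.NumberField`),
sibling of `UniformClassGroupPNT.lean`, which vendors Thorner–Zaman's uniform prime ideal theorem in
ideal classes of imaginary quadratic fields (named fact
`ThornerZaman2019_classPNT_imaginaryQuadratic`, [ThornerZaman2019, Thm. 1.4]) and defines the
counting function `π_C(x) = primeIdealClassCount K C x`.  Everything in this file is PROVED (two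
definitions with bodies, theorems; no named fact).

This is the first, elementary, brick of the printed proof of [ThornerZaman2019, Thm. 1.4]
specialised to the Hilbert class field `H_K/K` (their §2.1): the prime counting function of a
class is recovered from a Chebyshev-type function by partial summation (their Lemma 2.1,
`π_C(x) = ψ_C(x)/log x + ∫ ψ_C(t) dt/(t log² t) + O(…)`).  As in the tree's treatment of `π_K`
(`PrimeIdealChebyshev.lean`, Landau 1903 §13) we work with `θ` rather than `ψ` and prove an
exact identity:

* `normPrimeIdealClassCount K C n` — `G_C(n)`, the number of prime ideals of norm exactly `n` in
  the class `C ∈ Cl(K)`; `∑_C G_C(n) = G(n)` (`sum_normPrimeIdealClassCount`).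
* `chebyshevThetaIdealClass K C x` — `θ_C(x) = ∑_{n ≤ x} G_C(n) log n = ∑_{N𝔭 ≤ x, [𝔭] = C} log N𝔭`
  (`chebyshevThetaIdealClass_eq_sum_primeIdealsInClassLE`); `0 ≤ θ_C ≤ θ_K`,
  `∑_C θ_C = θ_K` (`sum_chebyshevThetaIdealClass`), `∑_C π_C = π_K` (`sum_primeIdealClassCount`).
* `primeIdealClassCount_eq_sum_normPrimeIdealClassCount` — `π_C(x) = ∑_{n ≤ x} G_C(n)`.
* `primeIdealClassCount_eq_theta_div_log_add_integral` — **partial summation**: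
  `π_C(x) = θ_C(x)/log x + ∫₂ˣ θ_C(t) dt/(t log² t)` for `x ≥ 2` (the class version of the tree's
  `primeIdealCount_eq_theta_div_log_add_integral` and of Mathlib's
  `Chebyshev.primeCounting_eq_theta_div_log_add_integral`, whose proof is followed).

## References

* J. Thorner, A. Zaman, *A unified and improved Chebotarev density theorem*, Algebra Number
  Theory 13 (2019) 1039–1068, §2.1 (Lemma 2.1). [ThornerZaman2019]
* E. Landau, *Neuer Beweis des Primzahlsatzes und Beweis des Primidealsatzes*, Math. Ann. 56
  (1903), §13. [LandauMathAnn1903]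
-/

noncomputable section

open scoped NumberField nonZeroDivisors
open Finset Real MeasureTheory

namespace Literature.NumberTheory.LFunctions.NumberField

variable (K : Type*) [Field K] [NumberField K]

/-! ### `G_C(n)` and `θ_C` -/

/-- `G_C(n)`: the number of prime ideals `𝔭` of `𝓞 K` with absolute norm `N𝔭 = n` lying in the
ideal class `C ∈ Cl(K)` (such `𝔭` are nonzero; the class is `ClassGroup.mk0`).  Summing over the
classes gives Landau's `G(n) = normPrimeIdealCount K n` (`sum_normPrimeIdealClassCount`).
[cite: ThornerZaman2019, §2.1] -/
def normPrimeIdealClassCount (C : ClassGroup (𝓞 K)) (n : ℕ) : ℕ :=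
  {P : Ideal (𝓞 K) | P.IsPrime ∧ Ideal.absNorm P = n ∧
    ∃ hP : P ∈ (Ideal (𝓞 K))⁰, ClassGroup.mk0 ⟨P, hP⟩ = C}.ncard

/-- The Chebyshev function of the ideal class `C ∈ Cl(K)`,
`θ_C(x) = ∑_{n ≤ x} G_C(n) log n = ∑_{N𝔭 ≤ x, [𝔭] = C} log N𝔭` (the second form is
`chebyshevThetaIdealClass_eq_sum_primeIdealsInClassLE`); Thorner–Zaman's `θ_C(x)` of the proof of
their Lemma 2.1, for `L/F = H_K/K`.  For `x < 0` the value is `0`. [cite: ThornerZaman2019, §2.1 Lemma 2.1] -/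
def chebyshevThetaIdealClass (C : ClassGroup (𝓞 K)) (x : ℝ) : ℝ :=
  ∑ n ∈ Icc 0 ⌊x⌋₊, (normPrimeIdealClassCount K C n : ℝ) * Real.log n

variable {K}

/-- The primes of norm `n` in a class are among the nonzero primes of norm `n`. [folklore] -/
theorem setOf_prime_absNorm_eq_class_subset (C : ClassGroup (𝓞 K)) (n : ℕ) :
    {P : Ideal (𝓞 K) | P.IsPrime ∧ Ideal.absNorm P = n ∧
        ∃ hP : P ∈ (Ideal (𝓞 K))⁰, ClassGroup.mk0 ⟨P, hP⟩ = C} ⊆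
      {P : Ideal (𝓞 K) | P.IsPrime ∧ P ≠ ⊥ ∧ Ideal.absNorm P = n} := by
  rintro P ⟨hP, hn, h0, -⟩
  exact ⟨hP, nonZeroDivisors.ne_zero h0, hn⟩

/-- There are finitely many primes of norm `n` in a class. [folklore] -/
theorem finite_setOf_prime_absNorm_eq_class (C : ClassGroup (𝓞 K)) (n : ℕ) :
    {P : Ideal (𝓞 K) | P.IsPrime ∧ Ideal.absNorm P = n ∧
        ∃ hP : P ∈ (Ideal (𝓞 K))⁰, ClassGroup.mk0 ⟨P, hP⟩ = C}.Finite :=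
  (finite_setOf_prime_absNorm_eq K n).subset (setOf_prime_absNorm_eq_class_subset C n)

/-- `G_C(n) ≤ G(n)`. [folklore] -/
theorem normPrimeIdealClassCount_le (C : ClassGroup (𝓞 K)) (n : ℕ) :
    normPrimeIdealClassCount K C n ≤ normPrimeIdealCount K n :=
  Set.ncard_le_ncard (setOf_prime_absNorm_eq_class_subset C n) (finite_setOf_prime_absNorm_eq K n)

/-- `G_C(0) = 0`. [folklore] -/
@[simp] theorem normPrimeIdealClassCount_zero (C : ClassGroup (𝓞 K)) :
    normPrimeIdealClassCount K C 0 = 0 :=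
  Nat.eq_zero_of_le_zero (by simpa using normPrimeIdealClassCount_le C 0)

/-- `G_C(1) = 0`. [folklore] -/
@[simp] theorem normPrimeIdealClassCount_one (C : ClassGroup (𝓞 K)) :
    normPrimeIdealClassCount K C 1 = 0 :=
  Nat.eq_zero_of_le_zero (by simpa using normPrimeIdealClassCount_le C 1)

/-- `θ_C ≥ 0`. [folklore] -/
theorem chebyshevThetaIdealClass_nonneg (C : ClassGroup (𝓞 K)) (x : ℝ) :
    0 ≤ chebyshevThetaIdealClass K C x :=
  sum_nonneg fun n _ ↦ mul_nonneg (Nat.cast_nonneg _) (Real.log_natCast_nonneg n)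

/-- `θ_C ≤ θ_K`. [folklore] -/
theorem chebyshevThetaIdealClass_le_chebyshevThetaIdeal (C : ClassGroup (𝓞 K)) (x : ℝ) :
    chebyshevThetaIdealClass K C x ≤ chebyshevThetaIdeal K x :=
  sum_le_sum fun n _ ↦ mul_le_mul_of_nonneg_right
    (by exact_mod_cast normPrimeIdealClassCount_le C n) (Real.log_natCast_nonneg n)

/-- `θ_C(x) = 0` for `x < 2` (only `n = 0, 1` occur). [folklore] -/
theorem chebyshevThetaIdealClass_eq_zero_of_lt_two (C : ClassGroup (𝓞 K)) {x : ℝ} (hx : x < 2) :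
    chebyshevThetaIdealClass K C x = 0 :=
  le_antisymm ((chebyshevThetaIdealClass_le_chebyshevThetaIdeal C x).trans
    (chebyshevThetaIdeal_eq_zero_of_lt_two K hx).le) (chebyshevThetaIdealClass_nonneg C x)

/-- `θ_C` is monotone in `x`. [folklore] -/
theorem chebyshevThetaIdealClass_mono (C : ClassGroup (𝓞 K)) :
    Monotone (chebyshevThetaIdealClass K C) := by
  intro x y hxy
  refine sum_le_sum_of_subset_of_nonneg (Icc_subset_Icc le_rfl (Nat.floor_le_floor hxy))
    fun n _ _ ↦ mul_nonneg (Nat.cast_nonneg _) (Real.log_natCast_nonneg n)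

/-! ### Counting fibrewise over the norm -/

/-- The fibre of the norm map over `n ≤ x` inside the primes of norm `≤ x` in the class `C` has
`G_C(n)` elements. [folklore] -/
theorem card_filter_primeIdealsInClassLE_absNorm_eq (C : ClassGroup (𝓞 K)) {x : ℝ} {n : ℕ}
    (hn : (n : ℝ) ≤ x) :
    (((finite_primeIdealsInClassLE C x).toFinset).filter (fun P ↦ Ideal.absNorm P = n)).card =
      normPrimeIdealClassCount K C n := by
  rw [normPrimeIdealClassCount, ← Set.ncard_coe_finset]
  congr 1
  ext P
  simp only [coe_filter, Set.Finite.mem_toFinset, primeIdealsInClassLE, Set.mem_setOf_eq]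
  constructor
  · rintro ⟨⟨h1, -, h3⟩, h4⟩
    exact ⟨h1, h4, h3⟩
  · rintro ⟨h1, h2, h3⟩
    exact ⟨⟨h1, by rw [h2]; exact hn, h3⟩, h2⟩

/-- Every prime of norm `≤ x` in a class has norm in `{0, …, ⌊x⌋}`. [folklore] -/
theorem absNorm_mem_Icc_of_mem_primeIdealsInClassLE (C : ClassGroup (𝓞 K)) {x : ℝ}
    {P : Ideal (𝓞 K)} (hP : P ∈ (finite_primeIdealsInClassLE C x).toFinset) :
    Ideal.absNorm P ∈ Icc 0 ⌊x⌋₊ := by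
  rw [Set.Finite.mem_toFinset] at hP
  exact mem_Icc.mpr ⟨Nat.zero_le _, Nat.le_floor hP.2.1⟩

variable (K) in
/-- **`π_C(x) = ∑_{n ≤ x} G_C(n)`** (counting the primes of the class fibrewise over the norm).
The hypothesis `0 ≤ x` is kept for convenience. [cite: ThornerZaman2019, §2.1] -/
theorem primeIdealClassCount_eq_sum_normPrimeIdealClassCount (C : ClassGroup (𝓞 K)) {x : ℝ}
    (hx : 0 ≤ x) :
    primeIdealClassCount K C x = ∑ n ∈ Icc 0 ⌊x⌋₊, normPrimeIdealClassCount K C n := by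
  classical
  rw [primeIdealClassCount, Set.ncard_eq_toFinset_card _ (finite_primeIdealsInClassLE C x),
    card_eq_sum_card_fiberwise (f := fun P ↦ Ideal.absNorm P) (t := Icc 0 ⌊x⌋₊)
      fun P hP ↦ absNorm_mem_Icc_of_mem_primeIdealsInClassLE C hP]
  refine sum_congr rfl fun n hn ↦ ?_
  convert card_filter_primeIdealsInClassLE_absNorm_eq C (x := x) (n := n) ?_
  exact (Nat.le_floor_iff hx).mp (mem_Icc.mp hn).2

variable (K) in
/-- **`θ_C(x) = ∑_{N𝔭 ≤ x, [𝔭] = C} log N𝔭`**, the defining sum regrouped by norm. The hypothesis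
`0 ≤ x` is kept for convenience. [cite: ThornerZaman2019, §2.1 Lemma 2.1] -/
theorem chebyshevThetaIdealClass_eq_sum_primeIdealsInClassLE (C : ClassGroup (𝓞 K)) {x : ℝ}
    (hx : 0 ≤ x) :
    chebyshevThetaIdealClass K C x =
      ∑ P ∈ (finite_primeIdealsInClassLE C x).toFinset, Real.log (Ideal.absNorm P) := by
  classical
  rw [chebyshevThetaIdealClass, ← sum_fiberwise_of_maps_to (g := fun P ↦ Ideal.absNorm P)
    (t := Icc 0 ⌊x⌋₊) (s := (finite_primeIdealsInClassLE C x).toFinset)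
    fun P hP ↦ absNorm_mem_Icc_of_mem_primeIdealsInClassLE C hP]
  refine sum_congr rfl fun n hn ↦ ?_
  have hnx : (n : ℝ) ≤ x := (Nat.le_floor_iff hx).mp (mem_Icc.mp hn).2
  rw [← card_filter_primeIdealsInClassLE_absNorm_eq C hnx,
    sum_congr rfl fun P hP ↦ by rw [(mem_filter.mp hP).2], sum_const, nsmul_eq_mul]

/-! ### Summing over the classes -/

variable (K) in
/-- **`∑_C G_C(n) = G(n)`**: every nonzero prime lies in exactly one class. [folklore] -/
theorem sum_normPrimeIdealClassCount (n : ℕ) :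
    ∑ C : ClassGroup (𝓞 K), normPrimeIdealClassCount K C n = normPrimeIdealCount K n := by
  classical
  let cl : Ideal (𝓞 K) → ClassGroup (𝓞 K) := fun P ↦
    if h : P ∈ (Ideal (𝓞 K))⁰ then ClassGroup.mk0 ⟨P, h⟩ else 1
  rw [normPrimeIdealCount, Set.ncard_eq_toFinset_card _ (finite_setOf_prime_absNorm_eq K n),
    card_eq_sum_card_fiberwise (f := cl) (t := univ) fun _ _ ↦ mem_univ _]
  refine sum_congr rfl fun C _ ↦ ?_
  rw [normPrimeIdealClassCount, Set.ncard_eq_toFinset_card _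
    (finite_setOf_prime_absNorm_eq_class C n)]
  congr 1
  ext P
  simp only [mem_filter, Set.Finite.mem_toFinset, Set.mem_setOf_eq]
  constructor
  · rintro ⟨hP, hn, h0, hC⟩
    refine ⟨⟨hP, nonZeroDivisors.ne_zero h0, hn⟩, ?_⟩
    change (if h : P ∈ (Ideal (𝓞 K))⁰ then ClassGroup.mk0 ⟨P, h⟩ else 1) = C
    rw [dif_pos h0]
    exact hC
  · rintro ⟨⟨hP, h0, hn⟩, hC⟩
    have h0' : P ∈ (Ideal (𝓞 K))⁰ := mem_nonZeroDivisors_of_ne_zero h0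
    change (if h : P ∈ (Ideal (𝓞 K))⁰ then ClassGroup.mk0 ⟨P, h⟩ else 1) = C at hC
    rw [dif_pos h0'] at hC
    exact ⟨hP, hn, h0', hC⟩

variable (K) in
/-- **`∑_C θ_C(x) = θ_K(x)`**. [folklore] -/
theorem sum_chebyshevThetaIdealClass (x : ℝ) :
    ∑ C : ClassGroup (𝓞 K), chebyshevThetaIdealClass K C x = chebyshevThetaIdeal K x := by
  simp only [chebyshevThetaIdealClass, chebyshevThetaIdeal]
  rw [sum_comm]
  refine sum_congr rfl fun n _ ↦ ?_
  rw [← sum_mul, ← Nat.cast_sum, sum_normPrimeIdealClassCount]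

variable (K) in
/-- **`∑_C π_C(x) = π_K(x)`**: the nonzero primes of norm `≤ x` are partitioned by their classes.
[folklore] -/
theorem sum_primeIdealClassCount (x : ℝ) :
    ∑ C : ClassGroup (𝓞 K), primeIdealClassCount K C x = primeIdealCount K x := by
  classical
  let cl : Ideal (𝓞 K) → ClassGroup (𝓞 K) := fun P ↦
    if h : P ∈ (Ideal (𝓞 K))⁰ then ClassGroup.mk0 ⟨P, h⟩ else 1
  rw [primeIdealCount, Set.ncard_eq_toFinset_card _ (finite_primeIdealsLE K x),
    card_eq_sum_card_fiberwise (f := cl) (t := univ) fun _ _ ↦ mem_univ _]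
  refine sum_congr rfl fun C _ ↦ ?_
  rw [primeIdealClassCount, Set.ncard_eq_toFinset_card _ (finite_primeIdealsInClassLE C x)]
  congr 1
  ext P
  simp only [mem_filter, Set.Finite.mem_toFinset, primeIdealsLE, primeIdealsInClassLE,
    Set.mem_setOf_eq]
  constructor
  · rintro ⟨hP, hx, h0, hC⟩
    refine ⟨⟨hP, nonZeroDivisors.ne_zero h0, hx⟩, ?_⟩
    change (if h : P ∈ (Ideal (𝓞 K))⁰ then ClassGroup.mk0 ⟨P, h⟩ else 1) = C
    rw [dif_pos h0]
    exact hC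
  · rintro ⟨⟨hP, h0, hx⟩, hC⟩
    have h0' : P ∈ (Ideal (𝓞 K))⁰ := mem_nonZeroDivisors_of_ne_zero h0
    change (if h : P ∈ (Ideal (𝓞 K))⁰ then ClassGroup.mk0 ⟨P, h⟩ else 1) = C at hC
    rw [dif_pos h0'] at hC
    exact ⟨hP, hx, h0', hC⟩

/-! ### Partial summation: `π_C` from `θ_C` -/

variable (K) in
/-- Integrability of `θ_C(t)/(t log² t)` on `[2, x]`. [folklore] -/
theorem integrableOn_chebyshevThetaIdealClass_div (C : ClassGroup (𝓞 K)) (x : ℝ) :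
    IntegrableOn (fun t ↦ chebyshevThetaIdealClass K C t / (t * Real.log t ^ 2)) (Set.Icc 2 x)
      volume := by
  have heq : (fun t ↦ chebyshevThetaIdealClass K C t / (t * Real.log t ^ 2)) =
      fun t ↦ (1 / (t * Real.log t ^ 2)) *
        ∑ n ∈ Icc 0 ⌊t⌋₊, (normPrimeIdealClassCount K C n : ℝ) * Real.log n := by
    ext t
    rw [chebyshevThetaIdealClass, div_eq_mul_one_div, mul_comm]
  rw [heq]
  refine integrableOn_mul_sum_Icc _ (by norm_num) <| ContinuousOn.integrableOn_Icc fun t ht ↦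
    ContinuousAt.continuousWithinAt ?_
  have h0 : t ≠ 0 := by linarith [ht.1]
  have h1 : t * Real.log t ^ 2 ≠ 0 :=
    mul_ne_zero h0 (pow_ne_zero _ (Real.log_ne_zero_of_pos_of_ne_one (by linarith [ht.1])
      (by linarith [ht.1])))
  fun_prop (disch := assumption)

variable (K) in
/-- **Partial summation for a class** (Thorner–Zaman, proof of Lemma 2.1, `θ`-form; Landau 1903,
§13): for `x ≥ 2`, `π_C(x) = θ_C(x)/log x + ∫₂ˣ θ_C(t) dt/(t log² t)`.  The proof follows the
tree's `primeIdealCount_eq_theta_div_log_add_integral` (Mathlib's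
`Chebyshev.primeCounting_eq_theta_div_log_add_integral` for `K = ℚ`).
[cite: ThornerZaman2019, §2.1 Lemma 2.1] -/
theorem primeIdealClassCount_eq_theta_div_log_add_integral (C : ClassGroup (𝓞 K)) {x : ℝ}
    (hx : 2 ≤ x) :
    (primeIdealClassCount K C x : ℝ) = chebyshevThetaIdealClass K C x / Real.log x +
      ∫ t in (2 : ℝ)..x, chebyshevThetaIdealClass K C t / (t * Real.log t ^ 2) := by
  have hx0 : (0 : ℝ) ≤ x := by linarith
  rw [primeIdealClassCount_eq_sum_normPrimeIdealClassCount K C hx0]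
  push_cast
  set a : ℕ → ℝ := fun n ↦ (normPrimeIdealClassCount K C n : ℝ) * Real.log n with ha
  trans ∑ n ∈ Icc 0 ⌊x⌋₊, (Real.log n)⁻¹ * a n
  · refine sum_congr rfl fun n _ ↦ ?_
    rcases Nat.lt_or_ge n 2 with h | h
    · interval_cases n <;> simp [a]
    · have : Real.log n ≠ 0 :=
        Real.log_ne_zero_of_pos_of_ne_one (by exact_mod_cast (by omega : 0 < n))
          (by exact_mod_cast (by omega : n ≠ 1))
      simp only [a]
      field_simp
  rw [sum_mul_eq_sub_integral_mul₁ a (f := fun t ↦ (Real.log t)⁻¹) (by simp [a]) (by simp [a]),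
    ← intervalIntegral.integral_of_le hx]
  · have int_deriv :
        ∫ u in (2 : ℝ)..x, deriv (fun x ↦ (Real.log x)⁻¹) u * ∑ k ∈ Icc 0 ⌊u⌋₊, a k =
        -∫ u in (2 : ℝ)..x, chebyshevThetaIdealClass K C u / (u * Real.log u ^ 2) := by
      rw [← intervalIntegral.integral_neg]
      refine intervalIntegral.integral_congr fun u _ ↦ ?_
      simp only [Real.deriv_inv_log_apply, chebyshevThetaIdealClass, a]
      ring
    rw [int_deriv]
    simp only [chebyshevThetaIdealClass, a]
    ring
  · -- Differentiability
    intro z ⟨_, _⟩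
    have : z ≠ 0 := by linarith
    have : Real.log z ≠ 0 := by apply Real.log_ne_zero_of_pos_of_ne_one <;> linarith
    fun_prop (disch := assumption)
  · -- Integrability of the derivative
    refine ContinuousOn.integrableOn_Icc fun z ⟨_, _⟩ ↦ ContinuousWithinAt.congr ?_
      (fun _ _ ↦ Real.deriv_inv_log_apply) Real.deriv_inv_log_apply
    have : z ≠ 0 := by linarith
    have : Real.log z ^ 2 ≠ 0 := by
      refine pow_ne_zero 2 <| Real.log_ne_zero_of_pos_of_ne_one ?_ ?_ <;> linarith
    exact ContinuousAt.continuousWithinAt <| by fun_prop (disch := assumption)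

/-- **`π_C(x) ≤ π_C(y)` for `x ≤ y`**. [folklore] -/
theorem primeIdealClassCount_mono (C : ClassGroup (𝓞 K)) : Monotone (primeIdealClassCount K C) := by
  intro x y hxy
  refine Set.ncard_le_ncard ?_ (finite_primeIdealsInClassLE C y)
  rintro P ⟨h1, h2, h3⟩
  exact ⟨h1, h2.trans hxy, h3⟩

/-- `π_C(x) = 0` for `x < 2` (a nonzero prime has norm `≥ 2`). [folklore] -/
theorem primeIdealClassCount_eq_zero_of_lt_two (C : ClassGroup (𝓞 K)) {x : ℝ} (hx : x < 2) :
    primeIdealClassCount K C x = 0 :=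
  Nat.eq_zero_of_le_zero ((primeIdealClassCount_le_primeIdealCount C x).trans
    (primeIdealCount_eq_zero_of_lt_two K hx).le)

end Literature.NumberTheory.LFunctions.NumberField

end
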